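import Summits.RiemannHypothesis.RiemannHypothesis.Theorems.GroundBartaPolarPerronFrobeniusGroundCriterion
import Summits.RiemannHypothesis.RiemannHypothesis.Theorems.PfPersistenceMarkovCore
import HarnessLib

/-!
# PF persistence — PERRON-FAKE (S6), part 1/3: the LOBE-BALANCE LAW (fold identity) for the full
# windowed form of an arbitrary weight table

`pub-rhpf` cell, unit `pub-rhpf-prover-perron` (S6; CASE-DAG §6 row PERRON-FAKE; node G1.PERRON).
**Mechanism / rigidity campaign; no RH claims.**  RH-free: Mathlib + proved tree files only; this
part declares NO definitions (the named objects — `tableSource`, `IsTableGround`,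
`PerronSourceDominated`, … — live in part 3, `PfPersistencePerronFakeNodeless`, which also carries the
overview, the honesty discussion and the references; part 2 is `…PerronFakeNodelessCriterion`).

Fix a window `a` and a REAL weight table `w : ℕ → ℝ` (no sign condition).  The full closed form of
the table read at `[-a, a]` is the tree's `Q^w_a = tableClosedForm a w = P + 𝓔^w_a − M^w_a‖·‖²`
(`PfPersistenceEdgeLawTables`), with form domain theory-1's finite-energy window class `coreAdm a`
(`PfPersistenceMarkovCore`).  For real `u` put `u⁺ = max(u,0)`, `u⁻ = max(−u,0)`; the **table
source** of `u` is the function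

  `S^w_u(y) = ∫_{(0,∞)} ρ(t)(u⁺(y+t) + u⁺(y−t)) dt + Σ_{log n < 2a} w(n)(u⁺(y+log n) + u⁺(y−log n))
              − 2∫ u⁺(x) cosh((x−y)/2) dx`                              (`ρ = weilArchDensity`)

(Markov attraction exerted on the point `y` by the positive lobe — archimedean kernel at every length
plus every atom of the table — minus the polar repulsion).

PROVED here: `tableClosedForm_abs_sub_eq_source` — the **lobe-balance law**
`Q^w_a(|u|) − Q^w_a(u) = −4∫ u⁻(y) S^w_u(y) dy` (with `u⁻S^w_u ∈ L¹`) for every real `u` in the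
window class and every real table: folding the negative lobe onto the positive one GAINS the Markov
attraction between the lobes and LOSES the polar repulsion; `S^w_u` is their pointwise balance.  The
case `w = Λ(n)n^{-1/2}` sits inside the tree's `PolarPerronFrobenius.swg_ae_nonneg_of_source_pos`
(GroundBarta G2), whose table-independent fold lemmas (`…GroundFold`, `swg_archGain_eq`) are reused
verbatim; plus the remark `tableSource_prime_nonneg` (for `w ≥ 0` the atoms only help).

References: R. Jentzsch, J. reine angew. Math. 141 (1912) 235–244; E. Bombieri, Rend. Mat. Acc.
Lincei (9) 11 (2000) 183–233, Thm 2 (p. 193); Z.-Q. Chen, M. Fukushima, *Symmetric Markov Processes,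
Time Change, and Boundary Theory* (2012), Thm 1.1.3(e).
-/

set_option linter.dupNamespace false

noncomputable section

open MeasureTheory Set Filter Complex
open scoped Real Topology

namespace Summit.RiemannHypothesis.RiemannHypothesis.Theorems.PfPersistence

open Literature.NumberTheory.LFunctions
open Summit.RiemannHypothesis.RiemannHypothesis.Theorems.WeilGroundStateMarkovPart
open Summit.RiemannHypothesis.RiemannHypothesis.Theorems.PolarPerronFrobenius

/-! ## §1 A remark on non-negative tables -/

/-- For a NON-NEGATIVE table the atomic part of the source is `≥ 0`: the atoms only help. [folklore] -/
theorem tableSource_prime_nonneg {a : ℝ} {w : ℕ → ℝ} (hw : ∀ n ∈ weilPrimeIndex a, 0 ≤ w n)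
    (u : ℝ → ℝ) (y : ℝ) :
    0 ≤ ∑ n ∈ weilPrimeIndex a, w n * (max (u (y + Real.log n)) 0 + max (u (y - Real.log n)) 0) :=
  Finset.sum_nonneg fun n hn ↦ mul_nonneg (hw n hn) (add_nonneg (le_max_right _ _) (le_max_right _ _))


/-! ## §3 The lobe-balance law (fold identity) for the full form of a table -/

section Fold

variable {a : ℝ} {u : ℝ → ℝ}

/-- **Lobe-balance law / fold identity (PROVED).**  For a real `u` in the finite-energy window class
and `S = S^w_u` its table source (hypothesis `hS` spells it out; it becomes the tree's `tableSource` in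
part 3), `Q^w_a(|u|) − Q^w_a(u) = −4∫ u⁻(y) S(y) dy`, and `u⁻ S` is integrable. [folklore] -/
theorem tableClosedForm_abs_sub_eq_source (w : ℕ → ℝ) (hum : Measurable u)
    (hU : coreAdm a (fun x ↦ ((u x : ℝ) : ℂ))) (S : ℝ → ℝ)
    (hS : ∀ y, S y =
      (∫ t in Ioi (0 : ℝ), weilArchDensity t * (max (u (y + t)) 0 + max (u (y - t)) 0)) +
        (∑ n ∈ weilPrimeIndex a, w n * (max (u (y + Real.log n)) 0 + max (u (y - Real.log n)) 0)) -
        2 * ∫ x, max (u x) 0 * Real.cosh ((x - y) / 2)) :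
    tableClosedForm a w (fun x ↦ ((|u x| : ℝ) : ℂ)) - tableClosedForm a w (fun x ↦ ((u x : ℝ) : ℂ)) =
        -4 * ∫ y, max (-u y) 0 * S y ∧
      Integrable (fun y ↦ max (-u y) 0 * S y) := by
  set U : ℝ → ℂ := fun x ↦ ((u x : ℝ) : ℂ) with hUdef
  set A : ℝ → ℂ := fun x ↦ ((|u x| : ℝ) : ℂ) with hAdef
  have hU2 : MemLp U 2 volume := hU.1
  have hu2 : MemLp u 2 volume :=
    MemLp.of_le hU2 hum.aestronglyMeasurable (Eventually.of_forall fun x ↦ by simp [hUdef])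
  have hus' : ∀ x : ℝ, x ∉ Icc (-a) a → u x = 0 := fun x hx ↦ by
    have h := hU.2.1 x hx
    simpa [hUdef] using h
  have hus : ∀ᵐ x : ℝ, x ∉ Icc (-a) a → u x = 0 := Eventually.of_forall hus'
  have hp2 := swg_memLp_posPart hu2
  have hn2 := swg_memLp_negPart hu2
  -- finite energy of `U` and of the modulus `A = |u|`
  have hE : IntegrableOn (fun t ↦ weilArchDensity t * weilIncrement U t) (Ioi 0) := hU.2.2
  have hAeq : (fun x ↦ ((‖U x‖ : ℝ) : ℂ)) = A := by
    funext x; simp [hUdef, hAdef]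
  have hEA : IntegrableOn (fun t ↦ weilArchDensity t * weilIncrement A t) (Ioi 0) := by
    have h := finiteEnergy_norm hU2 hE
    rwa [hAeq] at h
  have hNA : ∫ x, ‖A x‖ ^ 2 = ∫ x, ‖U x‖ ^ 2 :=
    integral_congr_ae (Eventually.of_forall fun x ↦ by simp [hAdef, hUdef])
  -- fold identities (table-independent, from the tree)
  obtain ⟨harch, hIJ⟩ := swg_archGain_eq hum hu2 hE hEA
  have hpol := swg_weilPoleForm_abs_sub_eq hu2 hus
  -- the atomic part in source form
  have hsecℓ : ∀ ℓ : ℝ, Integrable fun x ↦ max (-u x) 0 * (max (u (x + ℓ)) 0 + max (u (x - ℓ)) 0) := by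
    intro ℓ
    have h1 : Integrable fun x ↦ max (-u x) 0 * max (u (x + ℓ)) 0 :=
      hn2.integrable_mul (hp2.comp_measurePreserving (measurePreserving_add_right volume ℓ))
    have h2 : Integrable fun x ↦ max (-u x) 0 * max (u (x - ℓ)) 0 :=
      hn2.integrable_mul (hp2.comp_measurePreserving (measurePreserving_sub_right volume ℓ))
    exact (h1.add h2).congr (Eventually.of_forall fun x ↦ by simp only [Pi.add_apply]; ring)
  have hprime : ∑ n ∈ weilPrimeIndex a, w n *
      (weilIncrement U (Real.log n) - weilIncrement A (Real.log n)) =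
      4 * ∫ x, max (-u x) 0 * ∑ n ∈ weilPrimeIndex a, w n *
        (max (u (x + Real.log n)) 0 + max (u (x - Real.log n)) 0) := by
    have hterm : ∀ n ∈ weilPrimeIndex a, w n *
        (weilIncrement U (Real.log n) - weilIncrement A (Real.log n)) =
        ∫ x, 4 * (w n *
          (max (-u x) 0 * (max (u (x + Real.log n)) 0 + max (u (x - Real.log n)) 0))) := by
      intro n _
      rw [swg_weilIncrement_sub_abs hu2 (Real.log n), ← integral_const_mul, ← integral_const_mul]
      refine integral_congr_ae (Eventually.of_forall fun x ↦ ?_); simp only; ring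
    rw [Finset.sum_congr rfl hterm, ← integral_finsetSum _ (fun n _ ↦ ?_), ← integral_const_mul]
    · refine integral_congr_ae (Eventually.of_forall fun x ↦ ?_)
      simp only [Finset.mul_sum]
      exact Finset.sum_congr rfl fun n _ ↦ by ring
    · exact ((hsecℓ (Real.log n)).const_mul _).const_mul _
  have hIP : Integrable fun x ↦ max (-u x) 0 * ∑ n ∈ weilPrimeIndex a, w n *
      (max (u (x + Real.log n)) 0 + max (u (x - Real.log n)) 0) := by
    have h := integrable_finsetSum (weilPrimeIndex a)
      (fun n _ ↦ ((hsecℓ (Real.log n)).const_mul (w n)))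
    refine h.congr (Eventually.of_forall fun x ↦ ?_)
    simp only [Finset.mul_sum]
    exact Finset.sum_congr rfl fun n _ ↦ by ring
  -- the polar piece is integrable against `u⁻`
  have hcosh : Continuous fun t : ℝ ↦ Real.cosh (t / 2) :=
    Real.continuous_cosh.comp (continuous_id.div_const 2)
  have hsinh : Continuous fun t : ℝ ↦ Real.sinh (t / 2) :=
    Real.continuous_sinh.comp (continuous_id.div_const 2)
  have hpi : Integrable fun x ↦ max (u x) 0 := swg_integrable_of_memLp hp2 (swg_posPart_ae_zero hus)
  have hni : Integrable fun x ↦ max (-u x) 0 := swg_integrable_of_memLp hn2 (swg_negPart_ae_zero hus)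
  have hIC : Integrable fun y ↦ max (-u y) 0 * ∫ x, max (u x) 0 * Real.cosh ((x - y) / 2) := by
    have ipc := swg_integrable_mul_continuous hpi (swg_posPart_ae_zero hus) hcosh
    have ips := swg_integrable_mul_continuous hpi (swg_posPart_ae_zero hus) hsinh
    have key : ∀ y, ∫ x, max (u x) 0 * Real.cosh ((x - y) / 2) =
        Real.cosh (y / 2) * (∫ x, max (u x) 0 * Real.cosh (x / 2)) -
          Real.sinh (y / 2) * ∫ x, max (u x) 0 * Real.sinh (x / 2) := by
      intro y
      have hpt : ∀ x, max (u x) 0 * Real.cosh ((x - y) / 2) =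
          Real.cosh (y / 2) * (max (u x) 0 * Real.cosh (x / 2)) -
            Real.sinh (y / 2) * (max (u x) 0 * Real.sinh (x / 2)) := by
        intro x; rw [show (x - y) / 2 = x / 2 - y / 2 by ring, Real.cosh_sub]; ring
      simp_rw [hpt]
      rw [integral_sub (ipc.const_mul _) (ips.const_mul _), integral_const_mul, integral_const_mul]
    simp_rw [key]
    have inc := swg_integrable_mul_continuous hni (swg_negPart_ae_zero hus) hcosh
    have ins := swg_integrable_mul_continuous hni (swg_negPart_ae_zero hus) hsinh
    have i3a : Integrable (fun y ↦ max (-u y) 0 * Real.cosh (y / 2) *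
        ∫ x, max (u x) 0 * Real.cosh (x / 2)) := inc.mul_const _
    have i3b : Integrable (fun y ↦ max (-u y) 0 * Real.sinh (y / 2) *
        ∫ x, max (u x) 0 * Real.sinh (x / 2)) := ins.mul_const _
    exact (i3a.sub i3b).congr (Eventually.of_forall fun y ↦ by simp only [Pi.sub_apply]; ring)
  -- the energy difference
  have hEdiff : tableDirichletEnergy a w U - tableDirichletEnergy a w A =
      (∑ n ∈ weilPrimeIndex a, w n *
        (weilIncrement U (Real.log n) - weilIncrement A (Real.log n))) +
      ∫ t in Ioi (0 : ℝ), weilArchDensity t * (weilIncrement U t - weilIncrement A t) := by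
    have harchsub : ∫ t in Ioi (0 : ℝ), weilArchDensity t * (weilIncrement U t - weilIncrement A t) =
        (∫ t in Ioi (0 : ℝ), weilArchDensity t * weilIncrement U t) -
          ∫ t in Ioi (0 : ℝ), weilArchDensity t * weilIncrement A t := by
      rw [← integral_sub hE hEA]
      refine integral_congr_ae (Eventually.of_forall fun t ↦ ?_); simp only; ring
    have hprimesub : ∑ n ∈ weilPrimeIndex a, w n *
        (weilIncrement U (Real.log n) - weilIncrement A (Real.log n)) =
        (∑ n ∈ weilPrimeIndex a, w n * weilIncrement U (Real.log n)) -
          ∑ n ∈ weilPrimeIndex a, w n * weilIncrement A (Real.log n) := by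
      rw [← Finset.sum_sub_distrib]
      exact Finset.sum_congr rfl fun n _ ↦ by ring
    unfold tableDirichletEnergy
    rw [harchsub, hprimesub]
    ring
  -- the source pairing
  have hInS : Integrable fun y ↦ max (-u y) 0 * S y := by
    refine ((hIJ.add hIP).sub (hIC.const_mul 2)).congr (Eventually.of_forall fun y ↦ ?_)
    simp only [Pi.add_apply, Pi.sub_apply, hS]
    ring
  have hsum : ∫ y, max (-u y) 0 * S y =
      (∫ y, max (-u y) 0 *
        ∫ t in Ioi (0 : ℝ), weilArchDensity t * (max (u (y + t)) 0 + max (u (y - t)) 0)) +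
      (∫ y, max (-u y) 0 * ∑ n ∈ weilPrimeIndex a, w n *
        (max (u (y + Real.log n)) 0 + max (u (y - Real.log n)) 0)) -
      2 * ∫ y, max (-u y) 0 * ∫ x, max (u x) 0 * Real.cosh ((x - y) / 2) := by
    have iA : Integrable (fun y ↦ max (-u y) 0 *
        (∫ t in Ioi (0 : ℝ), weilArchDensity t * (max (u (y + t)) 0 + max (u (y - t)) 0)) +
        max (-u y) 0 * ∑ n ∈ weilPrimeIndex a, w n *
          (max (u (y + Real.log n)) 0 + max (u (y - Real.log n)) 0)) := hIJ.add hIP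
    have iC : Integrable (fun y ↦ 2 * (max (-u y) 0 * ∫ x, max (u x) 0 * Real.cosh ((x - y) / 2))) :=
      hIC.const_mul 2
    have e : (fun y ↦ max (-u y) 0 * S y) = fun y ↦
        (max (-u y) 0 *
            (∫ t in Ioi (0 : ℝ), weilArchDensity t * (max (u (y + t)) 0 + max (u (y - t)) 0)) +
          max (-u y) 0 * ∑ n ∈ weilPrimeIndex a, w n *
            (max (u (y + Real.log n)) 0 + max (u (y - Real.log n)) 0)) -
        2 * (max (-u y) 0 * ∫ x, max (u x) 0 * Real.cosh ((x - y) / 2)) := by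
      funext y; simp only [hS]; ring
    rw [e, integral_sub iA iC, integral_add hIJ hIP, integral_const_mul]
  refine ⟨?_, hInS⟩
  have hM : tableMarkovConstant a w * ∫ x, ‖A x‖ ^ 2 = tableMarkovConstant a w * ∫ x, ‖U x‖ ^ 2 := by
    rw [hNA]
  unfold tableClosedForm
  rw [hsum]
  linarith [hpol, hEdiff, hprime, harch, hM]

end Fold

end Summit.RiemannHypothesis.RiemannHypothesis.Theorems.PfPersistence

end
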